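import Summits.BirchSwinnertonDyer.BirchSwinnertonDyer.Theorems.BiquadraticEisensteinDescentHeegnerTwistCouplingInSupplySqrtTwoFermatPin
import HarnessLib

set_option linter.dupNamespace false -- `Summit.BirchSwinnertonDyer.BirchSwinnertonDyer.Theorems.…` (summit = sub)
set_option autoImplicit false

/-!
# Crux `HeegnerTwistCouplingInSupply` (stmt-BirchSwinnertonDyer-21381) — the `j = 8000` corner on `p ≡ 5 (mod 8)`: CELL DATA FOR EVERY PRIME
# (`h(−ℓq₀) < p` by the class number formula above `11100`, by a kernel table below)

Route `BiquadraticEisensteinDescent` (cell `pub/bsd-wall`, width seat `bsd-wall-cm-bed-w2` g13; `--supports` 21381, helper). Sequel of `…SqrtTwoFermatPin`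
(`exists_cellPair_bound_five`: for every prime `p ≡ 5 (mod 8)`, `p ≥ 100`, a `(3,−)`-partner `ℓ` and a `(5,−)`-partner `q₀` with `7ℓq₀ ≤ 5p(8⌊√(p/2)⌋ + 5)`).

* §1 the lever with a general tangent point: `inv_pi_mul_sqrt_mul_log_lt_of_le_pow_six_tangent` (`x ≤ B⁶ p√p`, `T⁴ ≤ p`, `log a ≤ La`,
  `6(La − 1) < (3.14159/B⁴ − 6/a)·B·T` ⇒ `π⁻¹√x log x < p`; `a = e²` is `…RoundingPinCellData.inv_pi_mul_sqrt_mul_log_lt_of_le_pow_six`), the instance at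
  the bound of `exists_cellPair_bound_five` (`a = 20`, `La = 3`, `B = 1.265`, `T = 10.26`: `p ≥ 11100`), and `classNumber_lt_of_five_bound`;
* §2 kernel tables below `11100` (four `decide +kernel` over EVERY `n ≡ 5 (mod 8)`, prime or not: `ℓ ∈ {3,11,19,43,59,67,83,107,131,139,163}`,
  `q₀ ∈ {5,13,29,37,53,61,101,109,149}`, `n` a non-residue mod both, Cohen count `h(−ℓq₀) < n`; 1387 rows);
* §3 ★ `exists_cellData_five_all` — for EVERY prime `p ≡ 5 (mod 8)`: primes `ℓ ≡ 3`, `q₀ ≡ 5 (mod 8)` with `(ℓ/p) = (q₀/p) = −1` and `h(K) < p` for every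
  imaginary quadratic `K` of discriminant `−ℓq₀`. UNCONDITIONAL. Consumer: `…SqrtTwoAllFive` (the corner for ALL `p ≡ 5 (mod 8)`).

Nothing about the crux (all CM `W`; residual C⁺), `L`-values or BSD is asserted here; BSD is not proved by any of this. THEOREMS ONLY.
Supports stmt-BirchSwinnertonDyer-21381.
-/

noncomputable section

namespace Summit.BirchSwinnertonDyer.BirchSwinnertonDyer.Theorems.BiquadraticEisensteinDescentHeegnerTwistCouplingInSupplySqrtTwoAllFiveCellData

open Literature.NumberTheory.EllipticCurves Literature.NumberTheory.QuadraticFields Literature.NumberTheory.QuadraticFields.Quadratic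
open Summit.BirchSwinnertonDyer.BirchSwinnertonDyer.Theorems.BiquadraticEisensteinDescentHeegnerTwistCouplingInSupplySizeIndivisibleSharp
  (classNumber_lt_of_sqrt_mul_log_lt)
open Summit.BirchSwinnertonDyer.BirchSwinnertonDyer.Theorems.BiquadraticEisensteinDescentHeegnerTwistCouplingInSupplyPartnerTables
  (jacobiSym_eq_neg_one_of_forall_sq_ne)
open Summit.BirchSwinnertonDyer.BirchSwinnertonDyer.Theorems.BiquadraticEisensteinDescentHeegnerTwistCouplingInSupplyPartnerLadder
  (jacobiSym_eq_neg_one_of_table_one_mod_four classNumber_lt_of_count)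
open Summit.BirchSwinnertonDyer.BirchSwinnertonDyer.Theorems.BiquadraticEisensteinDescentHeegnerTwistCouplingInSupplySqrtTwoFermatPin
  (exists_cellPair_bound_five)

/-! ## §1 The lever with a general tangent point, and its instance at the five-bound -/

/-- **Size lever at `|d| ≤ B⁶·p^{3/2}`, tangent of `log` at `a`.** For real `0 < x ≤ B⁶·p·√p`, `0 < B`, `0 < T`, `T⁴ ≤ p`, `0 < a`, `log a ≤ La`,
`1 ≤ La` and `6(La − 1) < (3.14159/B⁴ − 6/a)·(B·T)`: `π⁻¹·√x·log x < p`. With `t = p^{1/4}`, `w = B·t`: `√x ≤ w³`,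
`log x ≤ 6 log w ≤ 6(w/a + La − 1)`, so `√x log x ≤ 6w⁴/a + 6(La−1)w³ < π w⁴/B⁴ = π p`. [folklore] -/
theorem inv_pi_mul_sqrt_mul_log_lt_of_le_pow_six_tangent {x B T a La : ℝ} {p : ℕ} (hx : 0 < x) (hB : 0 < B) (hT : 0 < T) (ha : 0 < a)
    (hla : Real.log a ≤ La) (hLa : 1 ≤ La) (hX : x ≤ B ^ 6 * (p : ℝ) * Real.sqrt p)
    (hK : 6 * (La - 1) < (3.14159 / B ^ 4 - 6 / a) * (B * T)) (hTp : T ^ 4 ≤ (p : ℝ)) :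
    Real.pi⁻¹ * Real.sqrt x * Real.log x < p := by
  have hp0 : (0 : ℝ) < p := lt_of_lt_of_le (by positivity) hTp
  have hπ : (0 : ℝ) < Real.pi := Real.pi_pos
  rcases le_or_gt x 1 with hx1 | hx1
  · have hlog : Real.log x ≤ 0 := Real.log_nonpos hx.le hx1
    have : Real.pi⁻¹ * Real.sqrt x * Real.log x ≤ 0 := mul_nonpos_of_nonneg_of_nonpos (by positivity) hlog
    linarith
  set u : ℝ := Real.sqrt p with hu
  set t : ℝ := Real.sqrt u with ht
  have hu0 : 0 ≤ u := Real.sqrt_nonneg _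
  have ht0 : 0 ≤ t := Real.sqrt_nonneg _
  have hu2 : u ^ 2 = p := Real.sq_sqrt hp0.le
  have ht2 : t ^ 2 = u := Real.sq_sqrt hu0
  have ht4 : t ^ 4 = p := by rw [show t ^ 4 = (t ^ 2) ^ 2 by ring, ht2, hu2]
  have hTt : T ≤ t := by
    by_contra h
    push Not at h
    have : t ^ 4 < T ^ 4 := pow_lt_pow_left₀ h ht0 (by norm_num)
    linarith
  have ht0' : 0 < t := hT.trans_le hTt
  set w : ℝ := B * t with hw
  have hw0 : 0 < w := mul_pos hB ht0'
  have hxw : x ≤ w ^ 6 := by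
    calc x ≤ B ^ 6 * p * Real.sqrt p := hX
      _ = B ^ 6 * t ^ 4 * t ^ 2 := by rw [ht4, ht2]
      _ = w ^ 6 := by rw [hw]; ring
  have hsqrt : Real.sqrt x ≤ w ^ 3 := by
    rw [show w ^ 3 = Real.sqrt ((w ^ 3) ^ 2) from (Real.sqrt_sq (by positivity)).symm]
    exact Real.sqrt_le_sqrt (by nlinarith [hxw])
  have hlogx : Real.log x ≤ 6 * Real.log w := by
    have h := Real.log_le_log hx hxw
    rwa [Real.log_pow] at h
  have hlogw : Real.log w ≤ w / a + (La - 1) := by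
    have h := Real.log_le_sub_one_of_pos (show 0 < w / a by positivity)
    rw [Real.log_div hw0.ne' ha.ne'] at h
    linarith
  have hlogx0 : 0 < Real.log x := Real.log_pos hx1
  have h1 : Real.sqrt x * Real.log x ≤ w ^ 3 * (6 * (w / a + (La - 1))) :=
    mul_le_mul hsqrt (by linarith) hlogx0.le (by positivity)
  have hπ' : (3.14159 : ℝ) < Real.pi := lt_trans (by norm_num) Real.pi_gt_d6
  have hcoef : 3.14159 / B ^ 4 - 6 / a ≤ Real.pi / B ^ 4 - 6 / a := by
    have h₁ : 3.14159 / B ^ 4 < Real.pi / B ^ 4 := div_lt_div_of_pos_right hπ' (by positivity)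
    linarith
  have hc0 : 0 ≤ 3.14159 / B ^ 4 - 6 / a := by
    by_contra h
    push Not at h
    have : (3.14159 / B ^ 4 - 6 / a) * (B * T) < 0 := mul_neg_of_neg_of_pos h (by positivity)
    nlinarith
  have hkey : 6 * (La - 1) < (Real.pi / B ^ 4 - 6 / a) * w := by
    calc 6 * (La - 1) < (3.14159 / B ^ 4 - 6 / a) * (B * T) := hK
      _ ≤ (3.14159 / B ^ 4 - 6 / a) * (B * t) := by gcongr
      _ ≤ (Real.pi / B ^ 4 - 6 / a) * w := by rw [hw]; exact mul_le_mul_of_nonneg_right hcoef (by positivity)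
  have hB4 : 0 < B ^ 4 := by positivity
  have hp' : (p : ℝ) = w ^ 4 / B ^ 4 := by
    rw [hw, mul_pow, ← ht4]
    field_simp
  have h2 : w ^ 3 * (6 * (w / a + (La - 1))) < Real.pi * p := by
    have hw3 : 0 < w ^ 3 := by positivity
    have h3 : 6 * (La - 1) * w ^ 3 < (Real.pi / B ^ 4 - 6 / a) * w * w ^ 3 := by nlinarith
    have expand : (Real.pi / B ^ 4 - 6 / a) * w * w ^ 3 = Real.pi * (w ^ 4 / B ^ 4) - 6 * w ^ 4 / a := by ring
    calc w ^ 3 * (6 * (w / a + (La - 1))) = 6 * w ^ 4 / a + 6 * (La - 1) * w ^ 3 := by ring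
      _ < Real.pi * (w ^ 4 / B ^ 4) := by linarith
      _ = Real.pi * p := by rw [hp']
  calc Real.pi⁻¹ * Real.sqrt x * Real.log x = Real.pi⁻¹ * (Real.sqrt x * Real.log x) := by ring
    _ ≤ Real.pi⁻¹ * (w ^ 3 * (6 * (w / a + (La - 1)))) := mul_le_mul_of_nonneg_left h1 (by positivity)
    _ < Real.pi⁻¹ * (Real.pi * p) := mul_lt_mul_of_pos_left h2 (by positivity)
    _ = p := by field_simp

/-- `log 20 ≤ 3` (`e³ = 20.0855… > 20`). [folklore] -/
theorem log_twenty_le_three : Real.log 20 ≤ 3 := by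
  rw [Real.log_le_iff_le_exp (by norm_num)]
  have hE : (2.7182818283 : ℝ) < Real.exp 1 := Real.exp_one_gt_d9
  have h3 : Real.exp 3 = Real.exp 1 ^ 3 := by rw [← Real.exp_nat_mul]; norm_num
  rw [h3]
  have h1 : (2.7182818283 : ℝ) ^ 3 ≤ Real.exp 1 ^ 3 := pow_le_pow_left₀ (by norm_num) hE.le 3
  have h2 : (20 : ℝ) ≤ (2.7182818283 : ℝ) ^ 3 := by norm_num
  linarith

/-- **The lever at the five-bound.** For naturals `0 < n`, `p ≥ 11100`, `s` with `2s² ≤ p` and `7n ≤ 5p(8s + 5)`: `π⁻¹·√n·log n < p`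
(`n ≤ 4.08·p^{3/2} ≤ 1.265⁶·p^{3/2}`; tangent at `a = 20`, `La = 3`, `B = 1.265`, `T = 10.26`, `T⁴ = 11081.9…`). [folklore] -/
theorem inv_pi_mul_sqrt_mul_log_lt_of_five_bound {n p s : ℕ} (hn : 0 < n) (h7 : 7 * n ≤ 5 * p * (8 * s + 5))
    (hss : 2 * (s * s) ≤ p) (hp : 11100 ≤ p) : Real.pi⁻¹ * Real.sqrt n * Real.log n < p := by
  have hp' : (11100 : ℝ) ≤ p := by exact_mod_cast hp
  refine inv_pi_mul_sqrt_mul_log_lt_of_le_pow_six_tangent (B := 1.265) (T := 10.26) (a := 20) (La := 3) (by exact_mod_cast hn)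
    (by norm_num) (by norm_num) (by norm_num) log_twenty_le_three (by norm_num) ?_ (by norm_num) (le_trans (by norm_num) hp')
  set u : ℝ := Real.sqrt p with hu
  have hp0 : (0 : ℝ) ≤ p := by positivity
  have hu0 : 0 ≤ u := Real.sqrt_nonneg _
  have hu2 : u ^ 2 = p := Real.sq_sqrt hp0
  have hu105 : (105.3 : ℝ) ≤ u := by
    rw [hu]
    exact Real.le_sqrt_of_sq_le (by linarith)
  have hs0 : (0 : ℝ) ≤ s := by positivity
  have hsu : (s : ℝ) ≤ 0.70711 * u := by
    have h1 : 2 * ((s : ℝ) * s) ≤ p := by exact_mod_cast hss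
    have h2 : (s : ℝ) ^ 2 ≤ (0.70711 * u) ^ 2 := by nlinarith
    exact le_of_pow_le_pow_left₀ (by norm_num) (by positivity) h2
  have h7' : 7 * (n : ℝ) ≤ 5 * (p : ℝ) * (8 * s + 5) := by exact_mod_cast h7
  have hmono : 5 * (p : ℝ) * (8 * s + 5) ≤ 5 * (p : ℝ) * (8 * (0.70711 * u) + 5) := by gcongr
  have hpoly : 5 * (p : ℝ) * (8 * (0.70711 * u) + 5) ≤ 7 * ((1.265 : ℝ) ^ 6 * p * u) := by
    rw [← hu2]
    nlinarith [mul_nonneg (mul_nonneg hu0 hu0) (sub_nonneg.2 hu105)]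
  linarith

/-- **`h(K) < p` at the five-bound** for every imaginary quadratic `K` of discriminant `−ℓq₀` (`q₀ ≡ 5 (mod 8)`, `7ℓq₀ ≤ 5p(8s + 5)`, `2s² ≤ p`,
`p ≥ 11100`): Oesterlé `h ≤ π⁻¹√|d| log|d|` (tree `classNumber_lt_of_sqrt_mul_log_lt`). [cite: Oesterle1988Gauss, II §3 Proposition p. 57 (27)] -/
theorem classNumber_lt_of_five_bound {p l q₀ s : ℕ} (hl : l.Prime) (hq₀ : q₀.Prime) (hq₀8 : q₀ % 8 = 5)
    (h7 : 7 * (l * q₀) ≤ 5 * p * (8 * s + 5)) (hss : 2 * (s * s) ≤ p) (hp : 11100 ≤ p) :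
    ∀ (K : Type) [Field K] [NumberField K], IsImaginaryQuadratic K →
      NumberField.discr K = -((l * q₀ : ℕ) : ℤ) → NumberField.classNumber K < p := by
  intro K _ _ hK hdK
  have h4 : 4 < (NumberField.discr K).natAbs := by
    rw [hdK, Int.natAbs_neg, Int.natAbs_natCast]
    have := hl.two_le
    have : 5 ≤ q₀ := by have := hq₀.two_le; omega
    nlinarith
  refine classNumber_lt_of_sqrt_mul_log_lt hK h4 ?_
  rw [hdK, Int.natAbs_neg, Int.natAbs_natCast]
  exact inv_pi_mul_sqrt_mul_log_lt_of_five_bound (Nat.mul_pos hl.pos hq₀.pos) h7 hss hp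

/-! ## §2 Kernel tables below `11100` -/

/-- The `(3,−)` candidates `{3, 11, 19, 43, 59, 67, 83, 107, 131, 139, 163}` are primes `≡ 3 (mod 8)`. [folklore] -/
theorem tableL3_spec : ∀ l ∈ [3, 11, 19, 43, 59, 67, 83, 107, 131, 139, 163], l.Prime ∧ l % 8 = 3 := by
  decide +kernel

/-- The `(5,−)` candidates `{5, 13, 29, 37, 53, 61, 101, 109, 149}` are primes `≡ 5 (mod 8)`. [folklore] -/
theorem tableL5_spec : ∀ q ∈ [5, 13, 29, 37, 53, 61, 101, 109, 149], q.Prime ∧ q % 8 = 5 := by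
  decide +kernel

/-- **Kernel table, `n < 2800`**: for EVERY `n ≡ 5 (mod 8)` below `2800` (prime or not), partners `ℓ`, `q₀` from the two lists with `n` a non-residue
mod `ℓ` and mod `q₀` and `h(−ℓq₀) < n` by Cohen's pair counter. [cite: Cohen1993, §5.3.1 Algorithm 5.3.5] -/
theorem tableFiveA : ∀ n ∈ Finset.range 2800, n % 8 = 5 →
    ∃ l ∈ [3, 11, 19, 43, 59, 67, 83, 107, 131, 139, 163], ∃ q ∈ [5, 13, 29, 37, 53, 61, 101, 109, 149],
      (∀ x < l, x * x % l ≠ n % l) ∧ (∀ x < q, x * x % q ≠ n % q) ∧ BinQF.classNumberCount (l * q) < n := by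
  decide +kernel

/-- **Kernel table, `2800 ≤ n < 5600`.** [cite: Cohen1993, §5.3.1 Algorithm 5.3.5] -/
theorem tableFiveB : ∀ n ∈ Finset.range 5600, 2800 ≤ n → n % 8 = 5 →
    ∃ l ∈ [3, 11, 19, 43, 59, 67, 83, 107, 131, 139, 163], ∃ q ∈ [5, 13, 29, 37, 53, 61, 101, 109, 149],
      (∀ x < l, x * x % l ≠ n % l) ∧ (∀ x < q, x * x % q ≠ n % q) ∧ BinQF.classNumberCount (l * q) < n := by
  decide +kernel

/-- **Kernel table, `5600 ≤ n < 8400`.** [cite: Cohen1993, §5.3.1 Algorithm 5.3.5] -/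
theorem tableFiveC : ∀ n ∈ Finset.range 8400, 5600 ≤ n → n % 8 = 5 →
    ∃ l ∈ [3, 11, 19, 43, 59, 67, 83, 107, 131, 139, 163], ∃ q ∈ [5, 13, 29, 37, 53, 61, 101, 109, 149],
      (∀ x < l, x * x % l ≠ n % l) ∧ (∀ x < q, x * x % q ≠ n % q) ∧ BinQF.classNumberCount (l * q) < n := by
  decide +kernel

/-- **Kernel table, `8400 ≤ n < 11100`.** [cite: Cohen1993, §5.3.1 Algorithm 5.3.5] -/
theorem tableFiveD : ∀ n ∈ Finset.range 11100, 8400 ≤ n → n % 8 = 5 →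
    ∃ l ∈ [3, 11, 19, 43, 59, 67, 83, 107, 131, 139, 163], ∃ q ∈ [5, 13, 29, 37, 53, 61, 101, 109, 149],
      (∀ x < l, x * x % l ≠ n % l) ∧ (∀ x < q, x * x % q ≠ n % q) ∧ BinQF.classNumberCount (l * q) < n := by
  decide +kernel

/-- **Cell data below `11100` (kernel table).** For every `p ≡ 5 (mod 8)`, `p < 11100`: primes `ℓ ≡ 3`, `q₀ ≡ 5 (mod 8)` with `(ℓ/p) = (q₀/p) = −1`
(`p ≡ 1 (mod 4)`: reciprocity without sign) and `h(K) < p` for every imaginary quadratic `K` of discriminant `−ℓq₀`. [cite: Cohen1993, §5.3.1 Algorithm 5.3.5] -/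
theorem exists_cellData_five_of_lt {p : ℕ} (hp8 : p % 8 = 5) (hlt : p < 11100) :
    ∃ l q₀ : ℕ, l.Prime ∧ l % 8 = 3 ∧ q₀.Prime ∧ q₀ % 8 = 5 ∧ jacobiSym (l : ℤ) p = -1 ∧ jacobiSym (q₀ : ℤ) p = -1 ∧
      ∀ (K : Type) [Field K] [NumberField K], IsImaginaryQuadratic K →
        NumberField.discr K = -((l * q₀ : ℕ) : ℤ) → NumberField.classNumber K < p := by
  obtain ⟨l, hlmem, q, hqmem, hresl, hresq, hh⟩ :
      ∃ l ∈ [3, 11, 19, 43, 59, 67, 83, 107, 131, 139, 163], ∃ q ∈ [5, 13, 29, 37, 53, 61, 101, 109, 149],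
        (∀ x < l, x * x % l ≠ p % l) ∧ (∀ x < q, x * x % q ≠ p % q) ∧ BinQF.classNumberCount (l * q) < p := by
    rcases Nat.lt_or_ge p 2800 with h₁ | h₁
    · exact tableFiveA p (Finset.mem_range.mpr h₁) hp8
    rcases Nat.lt_or_ge p 5600 with h₂ | h₂
    · exact tableFiveB p (Finset.mem_range.mpr h₂) h₁ hp8
    rcases Nat.lt_or_ge p 8400 with h₃ | h₃
    · exact tableFiveC p (Finset.mem_range.mpr h₃) h₂ hp8
    · exact tableFiveD p (Finset.mem_range.mpr hlt) h₃ hp8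
  obtain ⟨hl, hl8⟩ := tableL3_spec l hlmem
  obtain ⟨hq, hq8⟩ := tableL5_spec q hqmem
  refine ⟨l, q, hl, hl8, hq, hq8, ?_, jacobiSym_eq_neg_one_of_table_one_mod_four hq (by omega) (by omega) hresq, classNumber_lt_of_count hl hq hh⟩
  rw [jacobiSym.quadratic_reciprocity_one_mod_four' (Nat.odd_iff.mpr (by omega)) (by omega : p % 4 = 1)]
  exact jacobiSym_eq_neg_one_of_forall_sq_ne hl hresl

/-! ## §3 ★ Cell data for EVERY prime `p ≡ 5 (mod 8)` -/

/-- **Cell data above `11100`** (rounding trichotomy + Fermat pin + class number formula). [cite: Oesterle1988Gauss, II §3 Proposition p. 57 (27)] -/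
theorem exists_cellData_five_of_le {p : ℕ} (hp : p.Prime) (hp8 : p % 8 = 5) (hge : 11100 ≤ p) :
    ∃ l q₀ : ℕ, l.Prime ∧ l % 8 = 3 ∧ q₀.Prime ∧ q₀ % 8 = 5 ∧ jacobiSym (l : ℤ) p = -1 ∧ jacobiSym (q₀ : ℤ) p = -1 ∧
      ∀ (K : Type) [Field K] [NumberField K], IsImaginaryQuadratic K →
        NumberField.discr K = -((l * q₀ : ℕ) : ℤ) → NumberField.classNumber K < p := by
  obtain ⟨l, q₀, hl, hl8, hq₀, hq₀8, hJl, hJq, h7⟩ := exists_cellPair_bound_five hp hp8 (by omega)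
  have hss : 2 * (Nat.sqrt (p / 2) * Nat.sqrt (p / 2)) ≤ p := by
    have h1 := Nat.sqrt_le (p / 2)
    have h2 : 2 * (p / 2) ≤ p := Nat.mul_div_le p 2
    omega
  exact ⟨l, q₀, hl, hl8, hq₀, hq₀8, hJl, hJq, classNumber_lt_of_five_bound hl hq₀ hq₀8 h7 hss hge⟩

/-- ★ **CELL DATA FOR EVERY PRIME `p ≡ 5 (mod 8)`**: primes `ℓ ≡ 3 (mod 8)`, `q₀ ≡ 5 (mod 8)` with `(ℓ/p) = (q₀/p) = −1` and `h(K) < p` for every imaginary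
quadratic `K` of discriminant `−ℓq₀` — the supply half of the CELL-5 corner with NO fixed partner and NO residual. UNCONDITIONAL.
[cite: Oesterle1988Gauss, II §3 Proposition p. 57 (27)] [cite: Cohen1993, §5.3.1 Algorithm 5.3.5] -/
theorem exists_cellData_five_all {p : ℕ} (hp : p.Prime) (hp8 : p % 8 = 5) :
    ∃ l q₀ : ℕ, l.Prime ∧ l % 8 = 3 ∧ q₀.Prime ∧ q₀ % 8 = 5 ∧ jacobiSym (l : ℤ) p = -1 ∧ jacobiSym (q₀ : ℤ) p = -1 ∧
      ∀ (K : Type) [Field K] [NumberField K], IsImaginaryQuadratic K →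
        NumberField.discr K = -((l * q₀ : ℕ) : ℤ) → NumberField.classNumber K < p := by
  rcases Nat.lt_or_ge p 11100 with h | h
  · exact exists_cellData_five_of_lt hp8 h
  · exact exists_cellData_five_of_le hp hp8 h

end Summit.BirchSwinnertonDyer.BirchSwinnertonDyer.Theorems.BiquadraticEisensteinDescentHeegnerTwistCouplingInSupplySqrtTwoAllFiveCellData

end
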